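import Literature.AnabelianGeometry.SemiGraphs.TemperedVertexActionIntertwining
import Literature.AnabelianGeometry.SemiGraphs.TemperedReconstructionR4Proofs
import Literature.AnabelianGeometry.SemiGraphs.TemperedReconstructionR0CompatProofs
import Literature.AnabelianGeometry.SemiGraphs.TreeSystemFixedClosedEdges
import HarnessLib

/-!
# Node (closed-edge) actions are INTERTWINED along chart-compatible, locally open morphisms of semi-graphs of
# anabelioids ([SemiAnbd] Thm. 3.7 (ii)/(iii)/(iv), Ex. 3.10, Cor. 3.11 «compatible»; proof-only)

Mochizuki, *Semi-graphs of anabelioids*, Publ. RIMS **42** (2006), §3: Thm. 3.7 (iii)/(iv) p. 41 («the nontrivial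
intersections of distinct maximal compact subgroups … are precisely the edge-like subgroups … of closed edges»),
Thm. 3.7 (ii) p. 40 in its edge form `EdgeLikeDistinctAt` (abc-iut-w4-d075), Prop. 3.6 (iv) p. 39, Ex. 3.10 p. 44
l. 12–17 («… on which `Δ_i` acts … compatible with the actions»), Cor. 3.11 pp. 45–47 («compatible … functorial with
respect to `γ`»), Rmk. 3.9.1 p. 43 [cite: MochizukiSemiAnbd2006, Thm 3.7(iii)(iv) p.41]; [IUTchI] §2, proof of Prop.
2.4 (i) p. 50 (the action of `Π^tp_X` on the special fibre of `X_J`) [cite: Mochizuki2012, Prop 2.4(i) p.50]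
[claim: Mochizuki2012, status: disputed] (nothing of the IUT series is asserted here).

abc-iut cell, layer L3, seat abc-iut-L3-d2 gen 8, row «EDGE-INTERTWINING@CLOSED-EDGES» (L3-lead gen 8 δ5 (4) GO).
PROOF-ONLY (no `def`, no `instance`, no notation, no `Prop` fact): the NODE twin of gen 7's
`TemperedVertexActionIntertwining.lean`.  The Thm. 3.7 (iv) binder `MaximalCompactIffVerticialAt 𝒢'` and the edge form
of Thm. 3.7 (ii) `EdgeLikeDistinctAt 𝒢'` are DISPLAYED hypotheses at the TARGET only (theorems at finite / locally
finite / top.-cyclic graphs BY NAME: `maximalCompactIffVerticialAt_of_finiteGraph`, `edgeLikeDistinctAt_of_finiteGraph`,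
`…_of_isLocallyFinite`, `…_of_topCyclic`), never folded into a definition.  NO Cor. 3.9 / 3.11, no origin hypothesis.
(N) ★ `existsUnique_isClosedEdge_edgeLike_map`: a bicontinuous automorphism of `π₁^temp(𝒢)` PERMUTES the nodes
through their edge-like subgroups — the datum DEFINING a node action (as abc-iut-L3-t2's `actVertex`; the `def` is
left to a DEFS file).  (GE) ★ `edgeLikeSubgroups_map_of_intertwines`: `F : 𝒢 → 𝒢'` LOCALLY OPEN on edge groups, `φ`
compatible with `F` on edge homomorphisms up to conjugation (the body of `Hom.CompatE`; `Hom.compatE_of_induces`),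
`φ ∘ a = a' ∘ φ`: if `a` carries some edge-like subgroup of `e₁` to one of `e₂` (`F e₁`, `F e₂` nodes), then `a'`
carries EVERY edge-like subgroup of `F e₁` to one of `F e₂` — `φ` maps an edge-like subgroup onto a FINITE-INDEX
subgroup of an edge-like `L' = K₁ ∩ K₂` of `F e₁`; `a'(L') = a'(K₁) ∩ a'(K₂)` is edge-like of some node `u'` sharing a
finite-index subgroup with an edge-like subgroup of `F e₂`, so `u' = F e₂`.  (I2E) tower levels, `φ` descending
`γ : Δ_X → Δ_Y` with `γ(N^X_i) ⊆ N^Y_j`: ★ `edgeMap_eq_of_nodeDictionary_of_descends` — for ANY actions on the underlying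
semi-graphs whose node parts obey the dictionary «`g · e = e'` iff `autOfConj g` carries edge-like subgroups of `e` to
those of `e'`», `F (g · e) = γ(g) · F e` at every node: VERBATIM the NODE half of the edge clause (3) of the binder
`hLG` of abc-iut-L3-t11's `TemperedCuspidalAbsolutenessOfProCusps.lean` (Thm. 6.5 (iii) route).

HONEST LIMITS.  Nodes only (an edge-like subgroup of a CUSP is not an intersection of two maximal compacts, Rmk. 3.9.1):
the cusp part of clause (3) of `hLG` and the F-1704 residual (β′) are untouched.  Nothing here asserts anything for a
curve, asserts or refutes abc, or takes a side on [IUTchIII] Cor. 3.12; typed ≠ proved.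
-/

noncomputable section

namespace Literature.AnabelianGeometry.SemiGraphs

open ProfiniteSemiGraph Topology
open scoped Pointwise

universe u

/-- An open subgroup of a compact topological group has finite index. [folklore] -/
private theorem index_ne_zero_of_isOpen_cpt {G : Type u} [Group G] [TopologicalSpace G] [IsTopologicalGroup G]
    [CompactSpace G] (H : Subgroup G) (hH : IsOpen (H : Set G)) : H.index ≠ 0 := by
  haveI : DiscreteTopology (G ⧸ H) := QuotientGroup.discreteTopology_iff.mpr hH
  haveI : Finite (G ⧸ H) := finite_of_compact_of_discrete
  exact Subgroup.index_ne_zero_of_finite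

/-- A topological-group automorphism carries maximal compact subgroups to maximal compact subgroups. [folklore] -/
private theorem isMaximalCompactSubgroup_map_aut {G : Type u} [Group G] [TopologicalSpace G]
    [IsTopologicalGroup G] (e : G ≃ₜ* G) {K : Subgroup G} (hK : IsMaximalCompactSubgroup K) :
    IsMaximalCompactSubgroup (K.map e.toMonoidHom) := by
  refine ⟨?_, fun K' hK' hle => ?_⟩
  · rw [Subgroup.coe_map]; exact hK.1.image e.continuous
  · have hpre : IsCompact ((K'.map e.symm.toMonoidHom : Subgroup G) : Set G) := by
      rw [Subgroup.coe_map]; exact hK'.image e.symm.continuous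
    have hKle : K ≤ K'.map e.symm.toMonoidHom := fun k hk => ⟨e k, hle ⟨k, hk, rfl⟩, e.symm_apply_apply k⟩
    refine le_antisymm (fun y hy => ⟨e.symm y, ?_, e.apply_symm_apply y⟩) hle
    rw [← hK.2 _ hpre hKle]; exact ⟨y, hy, rfl⟩

/-- Images of conjugates: `e(x H x⁻¹) = e(x) e(H) e(x)⁻¹`. [folklore] -/
private theorem map_conj_map_aut {G : Type u} [Group G] [TopologicalSpace G] (e : G ≃ₜ* G) (H : Subgroup G)
    (x : G) : (H.map (MulAut.conj x).toMonoidHom).map e.toMonoidHom =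
      (H.map e.toMonoidHom).map (MulAut.conj (e x)).toMonoidHom := by
  rw [Subgroup.map_map, Subgroup.map_map]; congr 1; ext y
  show e (x * y * x⁻¹) = e x * e y * (e x)⁻¹; rw [map_mul, map_mul, map_inv]

namespace ProfiniteSemiGraph

section Nodes

variable {𝒢 : ProfiniteSemiGraph.{u}} (h𝒢 : 𝒢.Thm37Hypotheses) (c : TemperedPiChart 𝒢)
include h𝒢

/-- **Every NODE carries an edge homomorphism** (a closed edge has a branch abutting to a vertex;
`exists_isEdgeHom`). [cite: MochizukiSemiAnbd2006, Thm 3.7(iii) p.41] -/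
theorem exists_isEdgeHom_of_isClosedEdge {f : 𝒢.graph.Edge} (hf : 𝒢.graph.IsClosedEdge f) :
    ∃ ψ : 𝒢.Ge f →ₜ* c.G, IsEdgeHom c f ψ := by
  obtain ⟨b, -, w, -, -, hbf, -, hbw, -⟩ := SemiGraph.exists_branches_of_isClosedEdge hf
  subst hbf
  exact exists_isEdgeHom h𝒢.isQuasiCoherent h𝒢.isGaloisCountable h𝒢.isOfInjectiveType c b w hbw

/-- **Edge-like subgroups of a NODE are non-trivial** (the edge group is infinite and every edge homomorphism is
injective: Thm. 3.7 (i) `verticialInjective_holds` + injective type). [cite: MochizukiSemiAnbd2006, Thm 3.7(iii) p.41] -/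
theorem ne_bot_of_mem_edgeLikeSubgroups_of_isClosedEdge {f : 𝒢.graph.Edge} (hf : 𝒢.graph.IsClosedEdge f)
    {L : Subgroup c.G} (hL : L ∈ edgeLikeSubgroups c f) : L ≠ ⊥ := by
  obtain ⟨b, -, w, -, -, hbf, -, hbw, -⟩ := SemiGraph.exists_branches_of_isClosedEdge hf
  subst hbf
  obtain ⟨ψ, hψ, rfl⟩ := hL
  have hinj := injective_of_isEdgeHom verticialInjective_holds h𝒢 c b w hbw ψ hψ
  intro h0
  refine ne_bot_of_isOpen_ge h𝒢.toProp36Hypotheses hbw (U := ⊤) isOpen_univ (eq_bot_iff.mpr fun x _ => ?_)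
  have hx : ψ x ∈ ψ.toMonoidHom.range := ⟨x, rfl⟩
  rw [h0, Subgroup.mem_bot] at hx
  exact Subgroup.mem_bot.mpr (hinj (by rw [hx, map_one]))

/-- **An edge-like subgroup remembers its edge** under `EdgeLikeDistinctAt` (edge-like subgroups of distinct edges have
mutual index `0`, while `[L : L] = 1`). [cite: MochizukiSemiAnbd2006, Thm 3.7(ii)(iv) pp.40-41] -/
theorem edge_eq_of_mem_edgeLikeSubgroups (hED : EdgeLikeDistinctAt 𝒢) {e e' : 𝒢.graph.Edge} {L : Subgroup c.G}
    (hL : L ∈ edgeLikeSubgroups c e) (hL' : L ∈ edgeLikeSubgroups c e') : e = e' := by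
  by_contra hne
  have h0 := hED h𝒢 c e e' L L hL hL' hne
  rw [Subgroup.relIndex_self] at h0
  exact one_ne_zero h0

/-- **A bicontinuous automorphism of `π₁^temp(𝒢)` carries an edge-like subgroup of a NODE to an edge-like subgroup of
a node** (Thm. 3.7 (iv), second clause, at `𝒢`: `L = K₁ ∩ K₂ ↦ a(K₁) ∩ a(K₂)`). [cite: MochizukiSemiAnbd2006, Thm 3.7(iv) p.41] -/
theorem exists_isClosedEdge_map_mem_edgeLikeSubgroups (hiv : MaximalCompactIffVerticialAt 𝒢) (a : c.G ≃ₜ* c.G)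
    {e : 𝒢.graph.Edge} (he : 𝒢.graph.IsClosedEdge e) {L : Subgroup c.G} (hL : L ∈ edgeLikeSubgroups c e) :
    ∃ e' : 𝒢.graph.Edge, 𝒢.graph.IsClosedEdge e' ∧ L.map a.toMonoidHom ∈ edgeLikeSubgroups c e' := by
  have hLne := ne_bot_of_mem_edgeLikeSubgroups_of_isClosedEdge h𝒢 c he hL
  obtain ⟨K₁, K₂, hK₁, hK₂, hne, hLK⟩ := ((hiv h𝒢 c).2 L hLne).mpr ⟨e, he, hL⟩
  have hinj : Function.Injective a.toMonoidHom := fun x y h => a.injective h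
  refine ((hiv h𝒢 c).2 _ ?_).mp ⟨_, _, isMaximalCompactSubgroup_map_aut a hK₁,
    isMaximalCompactSubgroup_map_aut a hK₂, fun h => hne (Subgroup.map_injective hinj h), ?_⟩
  · rwa [Ne, Subgroup.map_eq_bot_iff_of_injective L hinj]
  · rw [hLK]; exact Subgroup.map_inf_eq K₁ K₂ _ hinj

/-- ★ (N) **A bicontinuous automorphism of `π₁^temp(𝒢)` PERMUTES the nodes through their edge-like subgroups**: for
every node `e` there is a unique node `e'` such that `a` carries the edge-like subgroups of `e` to edge-like subgroups
of `e'` ((iv)At, `EdgeLikeDistinctAt`, Prop. 3.2 conjugacy) — the datum defining the action of such automorphisms on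
nodes. [cite: MochizukiSemiAnbd2006, Thm 3.7(iv) p.41] -/
theorem existsUnique_isClosedEdge_edgeLike_map (hiv : MaximalCompactIffVerticialAt 𝒢) (hED : EdgeLikeDistinctAt 𝒢)
    (a : c.G ≃ₜ* c.G) {e : 𝒢.graph.Edge} (he : 𝒢.graph.IsClosedEdge e) :
    ∃! e' : 𝒢.graph.Edge, 𝒢.graph.IsClosedEdge e' ∧
      ∀ L ∈ edgeLikeSubgroups c e, L.map a.toMonoidHom ∈ edgeLikeSubgroups c e' := by
  obtain ⟨ψ₀, hψ₀⟩ := exists_isEdgeHom_of_isClosedEdge h𝒢 c he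
  have hL₀ : ψ₀.toMonoidHom.range ∈ edgeLikeSubgroups c e := ⟨ψ₀, hψ₀, rfl⟩
  obtain ⟨e', he', hmem⟩ := exists_isClosedEdge_map_mem_edgeLikeSubgroups h𝒢 c hiv a he hL₀
  refine ⟨e', ⟨he', fun L hL => ?_⟩,
    fun e'' he'' => edge_eq_of_mem_edgeLikeSubgroups h𝒢 c hED (he''.2 _ hL₀) hmem⟩
  obtain ⟨x, rfl⟩ := exists_conj_of_mem_edgeLikeSubgroups c hL₀ hL
  rw [map_conj_map_aut]
  exact conj_mem_edgeLikeSubgroups' c hmem _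

end Nodes

variable {𝒢 𝒢' : ProfiniteSemiGraph.{u}} (h𝒢' : 𝒢'.Thm37Hypotheses) (c : TemperedPiChart 𝒢)
  (c' : TemperedPiChart 𝒢') (F : Hom 𝒢 𝒢')
  (hFo : ∀ e, IsOpen ((F.hE e).toMonoidHom.range : Set (𝒢'.Ge (F.base.edgeMap e))))
  (φ : c.G →* c'.G)
  (hφ : ∀ (e : 𝒢.graph.Edge) (ψ : 𝒢.Ge e →ₜ* c.G) (ψ' : 𝒢'.Ge (F.base.edgeMap e) →ₜ* c'.G),
    IsEdgeHom c e ψ → IsEdgeHom c' (F.base.edgeMap e) ψ' →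
      ∃ g : c'.G, ∀ x, φ (ψ x) = g * ψ' (F.hE e x) * g⁻¹)

include hFo hφ

/-- **A homomorphism `φ : π₁^temp(𝒢) → π₁^temp(𝒢')` compatible with a morphism `F : 𝒢 → 𝒢'` that is locally open
on edge groups carries every edge-like subgroup of `e` onto a FINITE-INDEX subgroup of an edge-like subgroup of
`F e`** (as soon as `F e` carries an edge homomorphism; the image of `Π_e → Π_{F e}` is open in the profinite
`Π_{F e}`, hence of finite index). [cite: MochizukiSemiAnbd2006, Prop 3.6(iv) p.39] -/
theorem exists_edgeLike_ge_map_of_compatE {e : 𝒢.graph.Edge} {L : Subgroup c.G}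
    (hL : L ∈ edgeLikeSubgroups c e) (hex : ∃ ψ' : 𝒢'.Ge (F.base.edgeMap e) →ₜ* c'.G,
      IsEdgeHom c' (F.base.edgeMap e) ψ') :
    ∃ L' ∈ edgeLikeSubgroups c' (F.base.edgeMap e), L.map φ ≤ L' ∧ (L.map φ).relIndex L' ≠ 0 := by
  obtain ⟨ψ, hψ, rfl⟩ := hL
  obtain ⟨ψ', hψ'⟩ := hex
  obtain ⟨g, hg⟩ := hφ e ψ ψ' hψ hψ'
  -- `θ := γ_g ∘ ψ'`, an edge homomorphism at `F e` composed with an inner automorphism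
  let θ : 𝒢'.Ge (F.base.edgeMap e) →* c'.G := (MulAut.conj g).toMonoidHom.comp ψ'.toMonoidHom
  have hK' : θ.range ∈ edgeLikeSubgroups c' (F.base.edgeMap e) := by
    rw [show θ.range = ψ'.toMonoidHom.range.map (MulAut.conj g).toMonoidHom by rw [MonoidHom.map_range]]
    exact conj_mem_edgeLikeSubgroups' c' ⟨ψ', hψ', rfl⟩ g
  have hmap : ψ.toMonoidHom.range.map φ = ((F.hE e).toMonoidHom.range).map θ := by
    rw [MonoidHom.map_range, MonoidHom.map_range]; congr 1; ext x; exact hg x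
  refine ⟨θ.range, hK', ?_, ?_⟩
  · rw [hmap]; exact Subgroup.map_le_range θ _
  · rw [hmap, ← Subgroup.index_comap]
    intro h0
    have hdvd := Subgroup.index_dvd_of_le (Subgroup.le_comap_map θ (F.hE e).toMonoidHom.range)
    rw [h0] at hdvd
    exact index_ne_zero_of_isOpen_cpt _ (hFo e) (Nat.eq_zero_of_zero_dvd hdvd)

include h𝒢'

/-- ★ (GE) **Intertwined automorphisms act compatibly on nodes**: for `F`, `φ` as above and `a ∈ End(π₁^temp(𝒢))`,
`a' ∈ Aut(π₁^temp(𝒢'))` with `φ ∘ a = a' ∘ φ`, if `a` carries some edge-like subgroup of `e₁` to one of `e₂` and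
`F e₁`, `F e₂` are nodes of `𝒢'`, then `a'` carries every edge-like subgroup of `F e₁` to one of `F e₂` (Thm. 3.7
(iv), second clause, at `𝒢'`; `EdgeLikeDistinctAt 𝒢'`; Prop. 3.2). [cite: MochizukiSemiAnbd2006, Thm 3.7(ii)(iv) pp.40-41] -/
theorem edgeLikeSubgroups_map_of_intertwines (hiv' : MaximalCompactIffVerticialAt 𝒢') (hED' : EdgeLikeDistinctAt 𝒢')
    (a : c.G →* c.G) (a' : c'.G ≃ₜ* c'.G) (hcomm : ∀ x, φ (a x) = a' (φ x)) {e₁ e₂ : 𝒢.graph.Edge}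
    (he₁ : 𝒢'.graph.IsClosedEdge (F.base.edgeMap e₁)) (he₂ : 𝒢'.graph.IsClosedEdge (F.base.edgeMap e₂))
    (h₁₂ : ∃ L ∈ edgeLikeSubgroups c e₁, L.map a ∈ edgeLikeSubgroups c e₂) :
    ∀ L' ∈ edgeLikeSubgroups c' (F.base.edgeMap e₁),
      L'.map a'.toMonoidHom ∈ edgeLikeSubgroups c' (F.base.edgeMap e₂) := by
  obtain ⟨L, hL, hLa⟩ := h₁₂
  obtain ⟨L', hL', hle, hidx⟩ := exists_edgeLike_ge_map_of_compatE c c' F hFo φ hφ hL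
    (exists_isEdgeHom_of_isClosedEdge h𝒢' c' he₁)
  obtain ⟨Lw, hLw, hlew, -⟩ := exists_edgeLike_ge_map_of_compatE c c' F hFo φ hφ hLa
    (exists_isEdgeHom_of_isClosedEdge h𝒢' c' he₂)
  -- `a' L'` is an edge-like subgroup of some node `u'`
  obtain ⟨u', -, hu'⟩ := exists_isClosedEdge_map_mem_edgeLikeSubgroups h𝒢' c' hiv' a' he₁ hL'
  -- the common finite-index subgroup `φ (a L) = a' (φ L)` pins the node down: `u' = F e₂`
  have hinj : Function.Injective a'.toMonoidHom := fun x y h => a'.injective h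
  have hφaL : (L.map a).map φ = (L.map φ).map a'.toMonoidHom := by
    rw [Subgroup.map_map, Subgroup.map_map]; congr 1; ext x; exact hcomm x
  have h1 : ((L.map φ).map a'.toMonoidHom).relIndex (L'.map a'.toMonoidHom) ≠ 0 := by
    rw [Subgroup.relIndex_map_map_of_injective _ _ hinj]; exact hidx
  have hu'e : u' = F.base.edgeMap e₂ := by
    by_contra hne'
    have h0' : (Lw ⊓ L'.map a'.toMonoidHom).relIndex (L'.map a'.toMonoidHom) = 0 := by
      rw [Subgroup.inf_relIndex_right]; exact hED' h𝒢' c' u' (F.base.edgeMap e₂) _ _ hu' hLw hne'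
    refine h1 (Subgroup.relIndex_eq_zero_of_le_left (le_inf ?_ (Subgroup.map_mono hle)) h0')
    rw [← hφaL]; exact hlew
  subst hu'e
  intro L'' hL''
  obtain ⟨x, rfl⟩ := exists_conj_of_mem_edgeLikeSubgroups c' hL' hL''
  rw [map_conj_map_aut]
  exact conj_mem_edgeLikeSubgroups' c' hu' _

end ProfiniteSemiGraph

namespace SpecialFibreTower

variable {ΓX : Type u} [Group ΓX] [TopologicalSpace ΓX] [IsTopologicalGroup ΓX] {ΔX : Subgroup ΓX}
  [ΔX.Normal] {ΓY : Type u} [Group ΓY] [TopologicalSpace ΓY] [IsTopologicalGroup ΓY] {ΔY : Subgroup ΓY}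
  [ΔY.Normal] (TX : SpecialFibreTower ΔX) (TY : SpecialFibreTower ΔY)
  (hP0X : ∀ i, ((TX.admKer i).map ΔX.subtype).Normal) (hP0Y : ∀ j, ((TY.admKer j).map ΔY.subtype).Normal)
  {i j : ℕ} (hivY : MaximalCompactIffVerticialAt (TY.Gc j)) (hEDY : EdgeLikeDistinctAt (TY.Gc j))
  (F : Hom (TX.Gc i) (TY.Gc j))
  (hFo : ∀ e, IsOpen ((F.hE e).toMonoidHom.range : Set ((TY.Gc j).Ge (F.base.edgeMap e))))
  (φ : (TX.chart i).G →* (TY.chart j).G)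
  (hφ : ∀ (e : (TX.Gc i).graph.Edge) (ψ : (TX.Gc i).Ge e →ₜ* (TX.chart i).G)
    (ψ' : (TY.Gc j).Ge (F.base.edgeMap e) →ₜ* (TY.chart j).G),
    IsEdgeHom (TX.chart i) e ψ → IsEdgeHom (TY.chart j) (F.base.edgeMap e) ψ' →
      ∃ g : (TY.chart j).G, ∀ x, φ (ψ x) = g * ψ' (F.hE e x) * g⁻¹)
  (γ : ΔX →* ΔY) (hN : ∀ n : ΔX, n ∈ TX.N i → γ n ∈ TY.N j)
  (hφγ : ∀ n : TX.N i, φ (TX.adm i n) = TY.adm j ⟨γ n, hN n n.2⟩)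

include hivY hEDY hFo hφ hφγ

/-- (I2E) **The node dictionaries of two tower levels are intertwined** along a chart-compatible, locally open
morphism of the level fibres whose `φ` descends a homomorphism `γ : Δ_X → Δ_Y` carrying `N^X_i` into `N^Y_j` along
the admissible quotients (Cor. 3.11 proof p. 47 (i): «open subgroups … that correspond via `γ`»): for `g ∈ Δ_X`,
`autOfConj_Y (γ g)` carries the edge-like subgroups of `F e₁` to those of `F e₂` whenever `autOfConj_X g` carries
some edge-like subgroup of the node `e₁` to one of the node `e₂`. [cite: MochizukiSemiAnbd2006, Cor 3.11 pp.45-47] -/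
theorem edgeLike_map_autOfConj_of_descends (g : ΔX) {e₁ e₂ : (TX.Gc i).graph.Edge}
    (he₁ : (TX.Gc i).graph.IsClosedEdge e₁) (he₂ : (TX.Gc i).graph.IsClosedEdge e₂)
    (h₁₂ : ∃ L ∈ edgeLikeSubgroups (TX.chart i) e₁,
      L.map (TX.autOfConj hP0X i (g : ΓX)).toMonoidHom ∈ edgeLikeSubgroups (TX.chart i) e₂) :
    ∀ L' ∈ edgeLikeSubgroups (TY.chart j) (F.base.edgeMap e₁),
      L'.map (TY.autOfConj hP0Y j ((γ g : ΔY) : ΓY)).toMonoidHom ∈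
        edgeLikeSubgroups (TY.chart j) (F.base.edgeMap e₂) := by
  -- `γ|_{N_i}` as a homomorphism of the levels, carrying conjugation by `g` to conjugation by `γ g`
  let γN : TX.N i →* TY.N j :=
    { toFun := fun n => ⟨γ n, hN n n.2⟩
      map_one' := Subtype.ext (by simp)
      map_mul' := fun n m => Subtype.ext (by simp) }
  have hγ : ∀ n : TX.N i, γN (TX.conjN i (g : ΓX) n) = TY.conjN j ((γ g : ΔY) : ΓY) (γN n) := by
    intro n
    apply Subtype.ext; apply Subtype.ext
    have h1 : ((TX.conjN i (g : ΓX) n : TX.N i) : ΔX) = g * (n : ΔX) * g⁻¹ :=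
      Subtype.ext (by simp [SpecialFibreTower.conjN])
    have h2 : ((TY.conjN j ((γ g : ΔY) : ΓY) (γN n) : TY.N j) : ΔY) = γ g * γ (n : ΔX) * (γ g)⁻¹ :=
      Subtype.ext (by simp [SpecialFibreTower.conjN, γN])
    change (((γN (TX.conjN i (g : ΓX) n) : TY.N j) : ΔY) : ΓY) = _
    rw [h2]
    change ((γ ((TX.conjN i (g : ΓX) n : TX.N i) : ΔX) : ΔY) : ΓY) = _
    rw [h1, map_mul, map_mul, map_inv]
  exact edgeLikeSubgroups_map_of_intertwines (TY.hyp j) (TX.chart i) (TY.chart j) F hFo φ hφ hivY hEDY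
    (TX.autOfConj hP0X i (g : ΓX)).toMonoidHom (TY.autOfConj hP0Y j ((γ g : ΔY) : ΓY))
    (TX.autOfConj_intertwines_of_descends TY hP0X hP0Y φ γN hφγ hγ)
    (SemiGraph.isClosedEdge_edgeMap F.base he₁) (SemiGraph.isClosedEdge_edgeMap F.base he₂) h₁₂

/-- ★ (I2E) **`F (g · e) = γ(g) · F e` at every NODE, for any actions on the underlying semi-graphs whose node parts
obey the dictionary** «`g · e = e'` iff `autOfConj g` carries the edge-like subgroups of the node `e` to edge-like
subgroups of `e'`» (the node analogue of abc-iut-L3-t2's `actVertex_apply_eq_iff`): VERBATIM the NODE half of the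
edge clause (3) of the Thm. 6.5 (iii) binder `hLG` (`(FI i) ((AX i g) e) = (AY i (γ g)) ((FI i) e)`), hypothesis =
chart-compatibility of `F` with a `φ` descending `γ|_{N_i}`. [cite: MochizukiSemiAnbd2006, Cor 3.11 pp.45-47] -/
theorem edgeMap_eq_of_nodeDictionary_of_descends
    (AX : ΓX →* CategoryTheory.Aut (TX.Gc i).graph) (AY : ΓY →* CategoryTheory.Aut (TY.Gc j).graph)
    (hAX : ∀ (g : ΓX) (e e' : (TX.Gc i).graph.Edge), (TX.Gc i).graph.IsClosedEdge e →
      ((AX g).hom.edgeMap e = e' ↔ ∀ L ∈ edgeLikeSubgroups (TX.chart i) e,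
        L.map (TX.autOfConj hP0X i g).toMonoidHom ∈ edgeLikeSubgroups (TX.chart i) e'))
    (hAY : ∀ (g : ΓY) (e e' : (TY.Gc j).graph.Edge), (TY.Gc j).graph.IsClosedEdge e →
      ((AY g).hom.edgeMap e = e' ↔ ∀ L ∈ edgeLikeSubgroups (TY.chart j) e,
        L.map (TY.autOfConj hP0Y j g).toMonoidHom ∈ edgeLikeSubgroups (TY.chart j) e'))
    (g : ΔX) {e : (TX.Gc i).graph.Edge} (he : (TX.Gc i).graph.IsClosedEdge e) :
    F.base.edgeMap ((AX (g : ΓX)).hom.edgeMap e) = (AY ((γ g : ΔY) : ΓY)).hom.edgeMap (F.base.edgeMap e) := by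
  obtain ⟨ψ, hψ⟩ := exists_isEdgeHom_of_isClosedEdge (TX.hyp i) (TX.chart i) he
  have hL : ψ.toMonoidHom.range ∈ edgeLikeSubgroups (TX.chart i) e := ⟨ψ, hψ, rfl⟩
  exact ((hAY _ _ _ (SemiGraph.isClosedEdge_edgeMap F.base he)).2
    (TX.edgeLike_map_autOfConj_of_descends TY hP0X hP0Y hivY hEDY F hFo φ hφ γ hN hφγ g he
      (SemiGraph.isClosedEdge_edgeMap (AX (g : ΓX)).hom he) ⟨_, hL, (hAX (g : ΓX) e _ he).1 rfl _ hL⟩)).symm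

end SpecialFibreTower

end Literature.AnabelianGeometry.SemiGraphs

end
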